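import Mathlib.Topology.Algebra.Group.Quotient
import Mathlib.MeasureTheory.Function.ContinuousMapDense
import Literature.NumberTheory.ConnesConsani2023.ZetaCyclesUnfolding
import Literature.NumberTheory.Automorphic.MeyerRatTestFunction
import HarnessLib

/-!
# ζ-cycles: proof of Theorem 6.4 (= Theorem 1.1) of Connes–Consani 2023

RH-FREE corpus literature (Connes–Consani 2023, *Spectral triples and ζ-cycles*, §6; cell rh-crit C1,
row t11, discharge D7).  Sequel of `ZetaCycles.lean` (statements), `ZetaCyclesUnfolding.lean` and
`LFunctions/MuentzFormulaSchwartz.lean`.  Everything here is PROVED; no new named facts.  This file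
DISCHARGES the named facts `CC2023_mapEzeta`, `CC2023_gaussWitness_mem`, `CC2023_mellin_gaussWitness`,
`CC2023_thm_6_4_ii` and `CC2023_thm_6_4_i` of `ZetaCycles.lean`.  The theorem characterises zeros of
`ζ` ON the critical line by ζ-cycles; nothing in this file bears on the truth of RH.

Proof route (as printed, arXiv:2106.01715 p0019:L18–p0020:L1):
* eq. (𝓔 ζ): `mellin_connesE_schwartz` (Müntz's continuation, `b = 0` by the Riemann-sum bound);
* `⟨χ_s | Σ_μ 𝓔 f⟩ = L⁻¹ conj(ζ(½+is) 𝓜f(½+is))` (`inner_fourierLp_eq_zeta_mul_mellin`);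
* (ii): `ζ(½+is) = 0`, `sL = 2πn` ⇒ `χ_s ⊥ Σ_μ 𝓔(𝒮^ev_0)` ⇒ `χ_s ∈ 𝓗(L) ≠ 0`;
* (i): `χ_s ∈ 𝓗(L)` ⇒ `ζ(½+is) 𝓜f(½+is) = 0` for every `f ∈ 𝒮^ev_0` with `Σ_μ 𝓔(f) ∈ L²(C)`; the test
  function `f(x) = e^{-πx²} πx² (3 − 2πx²) = −2π² G₀(x)` (`G₀` = the tree's `Meyer.meyerTestFun`) has
  `𝓜f(w) = (1−w)/2 · π^{-w/2} Γ(w/2+1) ≠ 0` on the critical line, whence `ζ(½+is) = 0`.  That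
  `Σ_μ 𝓔(f)` is square integrable is Lemma 6.1 (ii) for Schwartz data, proved here in the stronger
  form "`Σ_μ 𝓔(f)` is continuous on the circle" (`continuous_sigmaE`).

## References

* A. Connes, C. Consani, *Spectral triples and ζ-cycles*, Enseign. Math. 69 (2023) 93–148,
  arXiv:2106.01715, §6, Lemma 6.1, Theorem 6.4 [ConnesConsani2023].
-/

noncomputable section

open scoped Topology SchwartzMap ENNReal ComplexConjugate
open Function Filter MeasureTheory Complex Set AddCircle
open Literature.NumberTheory.LFunctions
open Literature.NumberTheory.Automorphic.Meyer (meyerTestFun meyerTestFun_apply meyerTestFun_zero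
  meyerTestFun_neg mellin_meyerTestFun integral_meyerTestFun summable_schwartz_comp_nat_mul)

namespace Literature.NumberTheory.ConnesConsani2023.ZetaCycles

/-! ### Eq. (𝓔 ζ) for `𝒮^ev_0` — discharge of `CC2023_mapEzeta` -/

/-- **Eq. (𝓔 ζ) of the proof of Theorem 6.4** for `f ∈ 𝒮^ev_0` (discharge of the named fact
`CC2023_mapEzeta`; `∫_0^∞ f = 0` because `f` is even with `∫_ℝ f = 0`).
[cite: ConnesConsani2023, proof of Theorem 6.4, eq. (𝓔 ζ) (arXiv chunk p0019:L52–L89)] -/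
theorem CC2023_mapEzeta_holds : CC2023_mapEzeta := by
  intro f hf s hs hs1
  have hint : ∫ t in Ioi 0, f t = 0 := integral_Ioi_eq_zero_of_even f.integrable hf.1 hf.2.2
  exact mellin_connesE_schwartz f hint hs hs1

/-! ### Theorem 6.4 (ii) -/

/-- If `ζ(½ + is) = 0` and `sL = 2πn`, the character `χ_s = fourier n` is orthogonal to
`Σ_μ 𝓔(𝒮^ev_0)`, i.e. lies in `𝓗(L)` (proof of Theorem 6.4 (ii), p0019:L46–L95).
[cite: ConnesConsani2023, Theorem 6.4 (ii), proof (arXiv chunk p0019:L46–L95)] -/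
theorem fourierLp_mem_zetaCycleSpace {L : ℝ} [hL : Fact (0 < L)] {s : ℝ} {n : ℤ}
    (hsL : s * L = 2 * Real.pi * n) (hzeta : riemannZeta (1 / 2 + s * I) = 0) :
    (fourierLp 2 n : Lp ℂ 2 (@haarAddCircle L hL)) ∈ zetaCycleSpace L := by
  rw [zetaCycleSpace, Submodule.mem_orthogonal]
  intro u hu
  induction hu using Submodule.span_induction with
  | mem ξ hξ =>
    obtain ⟨f, hf, hξ'⟩ := hξ
    have hint : ∫ t in Ioi 0, f t = 0 := integral_Ioi_eq_zero_of_even f.integrable hf.1 hf.2.2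
    rw [← inner_conj_symm, inner_fourierLp_eq_zeta_mul_mellin f hint hξ' hsL, hzeta, zero_mul,
      map_zero, smul_zero, map_zero]
  | zero => exact inner_zero_left _
  | add x y _ _ hx hy => rw [inner_add_left, hx, hy, add_zero]
  | smul c x _ hx => rw [inner_smul_left, hx, mul_zero]

/-- The characters are non-zero vectors of `L²(C)` (they are orthonormal). [folklore] -/
private theorem fourierLp_ne_zero {L : ℝ} [hL : Fact (0 < L)] (n : ℤ) :
    (fourierLp 2 n : Lp ℂ 2 (@haarAddCircle L hL)) ≠ 0 := by
  intro h
  have h1 : ‖(fourierLp 2 n : Lp ℂ 2 (@haarAddCircle L hL))‖ = 1 := orthonormal_fourier.1 n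
  rw [h, norm_zero] at h1
  exact zero_ne_one h1

/-- **Theorem 6.4 (ii)** (discharge of `CC2023_thm_6_4_ii`): if `s > 0`, `ζ(½ + is) = 0` and
`sL = 2πn`, `n ≥ 1`, then the circle of length `L` is a ζ-cycle and `s` is in its spectrum.
RH-FREE; nothing here bears on the truth of RH.
[cite: ConnesConsani2023, Theorem 6.4 (ii) (arXiv chunk p0019:L16, proof L46–p0020:L1)] -/
theorem CC2023_thm_6_4_ii_holds : CC2023_thm_6_4_ii := by
  intro L hL s n _hs _hn hzeta hsL
  have hmem := fourierLp_mem_zetaCycleSpace (L := L) (n := (n : ℤ)) (by exact_mod_cast hsL) hzeta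
  refine ⟨?_, ⟨n, by exact_mod_cast hsL, hmem⟩⟩
  rw [isZetaCycle_iff_zetaCycleSpace_ne_bot]
  intro hbot
  rw [hbot, Submodule.mem_bot] at hmem
  exact fourierLp_ne_zero (L := L) n hmem

/-! ### The test function `f(x) = e^{-πx²} πx² (3 − 2πx²) = −2π² G₀(x)` -/

/-- The relation with the tree's `G₀ = meyerTestFun`: `gaussWitness x = −2π² · G₀(x)`. [folklore] -/
private theorem gaussWitness_eq (x : ℝ) :
    ((gaussWitness x : ℝ) : ℂ) = (-(2 * Real.pi ^ 2) : ℂ) • meyerTestFun x := by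
  rw [meyerTestFun_apply, gaussWitness, smul_eq_mul]
  have hπ : (Real.pi : ℂ) ≠ 0 := ofReal_ne_zero.2 Real.pi_ne_zero
  push_cast
  field_simp
  ring

/-- **The test function is in `𝒮^ev_0`** (discharge of `CC2023_gaussWitness_mem`): it is the Schwartz
function `−2π² · Re G₀`, even, vanishing at `0`, with `∫_ℝ f = −2π² Re ∫ G₀ = 0`
("one easily checks that `∫_0^∞ f = 0` and that `f ∈ 𝒮^ev_0`", p0019:L30).
[cite: ConnesConsani2023, proof of Theorem 6.4 (i) (arXiv chunk p0019:L30)] -/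
theorem CC2023_gaussWitness_mem_holds : CC2023_gaussWitness_mem := by
  set F : 𝓢(ℝ, ℝ) := (-(2 * Real.pi ^ 2) : ℝ) • SchwartzMap.postcompCLM Complex.reCLM meyerTestFun
    with hF_def
  have hFx : ∀ x, F x = -(2 * Real.pi ^ 2) * (meyerTestFun x).re := fun x => rfl
  have hre : ∀ x, (meyerTestFun x).re = (x ^ 4 - 3 / (2 * Real.pi) * x ^ 2) * Real.exp (-Real.pi * x ^ 2) := by
    intro x; rw [meyerTestFun_apply, ← ofReal_mul, ofReal_re]
  have hval : ∀ x, F x = gaussWitness x := by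
    intro x
    rw [hFx, hre, gaussWitness]
    have hπ : Real.pi ≠ 0 := Real.pi_ne_zero
    field_simp
    ring
  refine ⟨F, hval, fun x => ?_, ?_, ?_⟩
  · rw [hFx, hFx, meyerTestFun_neg]
  · rw [hFx, meyerTestFun_zero, zero_re, mul_zero]
  · simp_rw [hFx]
    rw [MeasureTheory.integral_const_mul]
    have h : ∫ x : ℝ, (meyerTestFun x).re = (∫ x : ℝ, meyerTestFun x).re := by
      have := integral_re (meyerTestFun.integrable (μ := (volume : Measure ℝ))) (𝕜 := ℂ)
      simpa using this
    rw [h, integral_meyerTestFun, zero_re, mul_zero]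

/-- **Mellin transform of the test function** (discharge of `CC2023_mellin_gaussWitness`): for
`Re w > 0`, `𝓜f(w) = (1 − w)/2 · π^{−w/2} · Γ(w/2 + 1)` (from the tree's
`𝓜G₀(w) = w(w−1)/(8π²) π^{−w/2} Γ(w/2)` and `Γ(w/2+1) = (w/2)Γ(w/2)`).
[cite: ConnesConsani2023, proof of Theorem 6.4 (i) (arXiv chunk p0019:L30–L44)] -/
theorem CC2023_mellin_gaussWitness_holds : CC2023_mellin_gaussWitness := by
  intro w hw
  have hfun : (fun x => ((gaussWitness x : ℝ) : ℂ)) = fun x => (-(2 * Real.pi ^ 2) : ℂ) • meyerTestFun x :=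
    funext gaussWitness_eq
  rw [hfun, mellin_const_smul, mellin_meyerTestFun hw, smul_eq_mul]
  have hw0 : w / 2 ≠ 0 := by
    intro h
    have := congrArg Complex.re h
    rw [div_ofNat_re, zero_re] at this
    linarith
  rw [Complex.Gamma_add_one _ hw0]
  have hπ : (Real.pi : ℂ) ≠ 0 := ofReal_ne_zero.2 Real.pi_ne_zero
  field_simp
  ring

/-- The Mellin transform of the test function does not vanish on the critical line:
`𝓜f(½ + is) = ¼(¼ + s²) π^{−¼−is/2} Γ(¼ + is/2) ≠ 0` (p0019:L33, L44). [cite: ConnesConsani2023, proof of Theorem 6.4 (i) (arXiv chunk p0019:L33–L46)] -/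
theorem mellin_gaussWitness_ne_zero (s : ℝ) :
    mellin (fun x => ((gaussWitness x : ℝ) : ℂ)) (1 / 2 + s * I) ≠ 0 := by
  rw [CC2023_mellin_gaussWitness_holds _ (by simp)]
  have h1 : (1 : ℂ) - (1 / 2 + s * I) ≠ 0 := by
    intro h
    have := congrArg Complex.re h
    norm_num at this
  have h2 : (Real.pi : ℂ) ^ (-(1 / 2 + (s : ℂ) * I) / 2) ≠ 0 := by
    rw [Ne, cpow_eq_zero_iff, not_and_or]
    exact Or.inl (ofReal_ne_zero.2 Real.pi_ne_zero)
  have h3 : Complex.Gamma ((1 / 2 + (s : ℂ) * I) / 2 + 1) ≠ 0 := by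
    apply Complex.Gamma_ne_zero_of_re_pos
    simp only [add_re, one_re, div_ofNat_re, mul_re, ofReal_re, I_re, mul_zero, ofReal_im, I_im,
      mul_one, sub_self, add_zero]
    norm_num
  exact mul_ne_zero (mul_ne_zero (div_ne_zero h1 two_ne_zero) h2) h3

/-! ### `Σ_μ 𝓔(f)` is continuous on the circle (Lemma 6.1 (ii), Schwartz case) -/

/-- `u ↦ Σ_{n ≥ 1} F(n u)` is continuous on `(0, ∞)` for a Schwartz `F` (locally uniform convergence:
`|F(nu)| ≤ C/(nu)²`). [folklore] -/
private theorem continuousOn_tsum_schwartz_comp_mul (F : 𝓢(ℝ, ℂ)) :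
    ContinuousOn (fun u : ℝ => ∑' n : ℕ, F (((n + 1 : ℕ) : ℝ) * u)) (Ioi 0) := by
  intro u₀ hu₀
  have ha : 0 < u₀ / 2 := half_pos hu₀
  set C := SchwartzMap.seminorm ℝ 2 0 F with hC
  -- uniform bound on `[u₀/2, ∞)`
  have hcont : ContinuousOn (fun u : ℝ => ∑' n : ℕ, F (((n + 1 : ℕ) : ℝ) * u)) (Ici (u₀ / 2)) := by
    refine continuousOn_tsum (u := fun n : ℕ => C / ((((n + 1 : ℕ) : ℝ)) * (u₀ / 2)) ^ 2)
      (fun n => (F.continuous.comp (continuous_const.mul continuous_id)).continuousOn) ?_ ?_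
    · have h := (summable_nat_add_iff (f := fun n : ℕ => (((n : ℝ)) ^ 2)⁻¹) 1).mpr
        (Real.summable_nat_pow_inv.mpr one_lt_two)
      refine (h.mul_left (C / (u₀ / 2) ^ 2)).congr fun n => ?_
      have hn0 : ((n + 1 : ℕ) : ℝ) ≠ 0 := by positivity
      field_simp
    · intro n u hu
      have hu' : u₀ / 2 ≤ u := hu
      have hupos : 0 < u := lt_of_lt_of_le ha hu'
      have hx : 0 < ((n + 1 : ℕ) : ℝ) * u := mul_pos (by positivity) hupos
      have hle := SchwartzMap.le_seminorm ℝ 2 0 F ((((n + 1 : ℕ) : ℝ)) * u)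
      rw [norm_iteratedFDeriv_zero, Real.norm_of_nonneg hx.le] at hle
      have hxa : ((n + 1 : ℕ) : ℝ) * (u₀ / 2) ≤ ((n + 1 : ℕ) : ℝ) * u := by gcongr
      have hxa0 : 0 < ((n + 1 : ℕ) : ℝ) * (u₀ / 2) := mul_pos (by positivity) ha
      calc ‖F ((((n + 1 : ℕ) : ℝ)) * u)‖ ≤ C / ((((n + 1 : ℕ) : ℝ)) * u) ^ 2 := by
            rw [le_div_iff₀ (pow_pos hx 2), mul_comm]; exact hle
        _ ≤ C / ((((n + 1 : ℕ) : ℝ)) * (u₀ / 2)) ^ 2 := by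
            apply div_le_div_of_nonneg_left (apply_nonneg _ _) (pow_pos hxa0 2)
            gcongr
  exact (hcont.continuousAt (Ici_mem_nhds (half_lt_self hu₀))).continuousWithinAt

/-- `x ↦ 𝓔(f)(eˣ)` is continuous on `ℝ` for a real Schwartz `f`. [folklore] -/
private theorem continuous_connesE_comp_exp (f : 𝓢(ℝ, ℝ)) :
    Continuous fun x : ℝ => ((connesE f (Real.exp x) : ℝ) : ℂ) := by
  set F : 𝓢(ℝ, ℂ) := SchwartzMap.postcompCLM Complex.ofRealCLM f with hF_def
  have hFx : ∀ x, F x = ((f x : ℝ) : ℂ) := fun x => rfl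
  have hfun : (fun x : ℝ => ((connesE f (Real.exp x) : ℝ) : ℂ)) =
      fun x => ((Real.sqrt (Real.exp x) : ℝ) : ℂ) * ∑' n : ℕ, F (((n + 1 : ℕ) : ℝ) * Real.exp x) := by
    funext x
    simp only [connesE, ofReal_mul, ofReal_tsum, hFx]
  rw [hfun]
  refine (continuous_ofReal.comp (Real.continuous_sqrt.comp Real.continuous_exp)).mul ?_
  exact (continuousOn_tsum_schwartz_comp_mul F).comp_continuous Real.continuous_exp
    fun x => Real.exp_pos x

/-- Two-sided exponential decay of `x ↦ 𝓔(f)(eˣ)` for a real Schwartz `f` with `∫_0^∞ f = 0`: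
`|𝓔(f)(eˣ)| ≤ M e^{-|x|/2}` (`𝓔(f)(u) = O(u^{1/2})` at `0` by the Riemann-sum bound, `O(u^{-3/2})` at `∞`;
Lemma 6.1 (i)). [cite: ConnesConsani2023, Lemma 6.1 (i) (arXiv chunk p0018:L23–L24, L51–L58)] -/
theorem norm_connesE_exp_le (f : 𝓢(ℝ, ℝ)) (hint : ∫ t in Ioi 0, f t = 0) :
    ∃ M : ℝ, 0 ≤ M ∧ ∀ x : ℝ, ‖((connesE f (Real.exp x) : ℝ) : ℂ)‖ ≤ M * Real.exp (-|x| / 2) := by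
  set F : 𝓢(ℝ, ℂ) := SchwartzMap.postcompCLM Complex.ofRealCLM f with hF_def
  have hFx : ∀ x, F x = ((f x : ℝ) : ℂ) := fun x => rfl
  have hFint : ∫ t in Ioi 0, F t = 0 := by
    simp only [hFx, integral_complex_ofReal, hint, Complex.ofReal_zero]
  set V : ℝ := ∫ t in Ioi 0, ‖deriv (⇑F) t‖ with hV
  set C' : ℝ := SchwartzMap.seminorm ℝ 2 0 F * (∑' n : ℕ, 1 / (((n + 1 : ℕ) : ℝ)) ^ 2) with hC'
  have hV0 : 0 ≤ V := integral_nonneg fun t => norm_nonneg _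
  have hC'0 : 0 ≤ C' := mul_nonneg (apply_nonneg _ _) (tsum_nonneg fun n => by positivity)
  refine ⟨V + C', add_nonneg hV0 hC'0, fun x => ?_⟩
  set u := Real.exp x with hu
  have hupos : 0 < u := Real.exp_pos x
  -- `‖𝓔(f)(u)‖ = √u · ‖Σ F(n u)‖`
  have hnorm : ‖((connesE f u : ℝ) : ℂ)‖ = Real.sqrt u * ‖∑' n : ℕ, F (((n + 1 : ℕ) : ℝ) * u)‖ := by
    have h1 : ((connesE f u : ℝ) : ℂ) = ((Real.sqrt u : ℝ) : ℂ) * ∑' n : ℕ, F (((n + 1 : ℕ) : ℝ) * u) := by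
      simp only [connesE, ofReal_mul, ofReal_tsum, hFx]
    rw [h1, norm_mul, Complex.norm_real, Real.norm_of_nonneg (Real.sqrt_nonneg u)]
  have hsqrt : Real.sqrt u = Real.exp (x / 2) := by rw [hu, Real.exp_half]
  rw [hnorm, hsqrt]
  rcases le_or_gt x 0 with hx | hx
  · -- `x ≤ 0`: Riemann-sum bound `‖Σ F(nu)‖ ≤ V`, and `e^{x/2} = e^{-|x|/2}`
    have hb := norm_tsum_schwartz_le_of_integral_eq_zero F hFint hupos
    have habs : -|x| / 2 = x / 2 := by rw [abs_of_nonpos hx]; ring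
    rw [habs]
    calc Real.exp (x / 2) * ‖∑' n : ℕ, F (((n + 1 : ℕ) : ℝ) * u)‖ ≤ Real.exp (x / 2) * V := by gcongr
      _ ≤ (V + C') * Real.exp (x / 2) := by nlinarith [Real.exp_pos (x / 2)]
  · -- `x > 0`: decay `‖Σ F(nu)‖ ≤ C' u^{-2}`, and `e^{x/2} e^{-2x} ≤ e^{-x/2} = e^{-|x|/2}`
    have hb := norm_tsum_schwartz_comp_mul_nat_le F (le_refl 2) hupos
    have habs : -|x| / 2 = -(x / 2) := by rw [abs_of_pos hx]; ring
    rw [habs]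
    have hu2 : (u ^ 2)⁻¹ = Real.exp (-(2 * x)) := by
      rw [hu, ← Real.exp_nat_mul, Real.exp_neg]; norm_num
    calc Real.exp (x / 2) * ‖∑' n : ℕ, F (((n + 1 : ℕ) : ℝ) * u)‖
        ≤ Real.exp (x / 2) * (C' * (u ^ 2)⁻¹) := by gcongr
      _ = C' * Real.exp (-(3 * x / 2)) := by
          rw [hu2, mul_comm (Real.exp (x / 2)), mul_assoc, ← Real.exp_add,
            show -(2 * x) + x / 2 = -(3 * x / 2) by ring]
      _ ≤ C' * Real.exp (-(x / 2)) := by gcongr; linarith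
      _ ≤ (V + C') * Real.exp (-(x / 2)) := by nlinarith [Real.exp_pos (-(x / 2))]

/-- A continuous `Φ : ℝ → ℂ` with `|Φ(y)| ≤ M e^{-|y|/2}` has a continuous `L`-periodisation
`x ↦ Σ_{k∈ℤ} Φ(x + kL)` (locally uniform convergence; Lemma 6.1 (ii): "the series … is geometrically
convergent", p0018:L24, L57–L58). [cite: ConnesConsani2023, Lemma 6.1 (ii) (arXiv chunk p0018:L24, L57–L58)] -/
theorem continuous_tsum_comp_add_int_mul {Φ : ℝ → ℂ} (hΦc : Continuous Φ) {M : ℝ} (hM : 0 ≤ M)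
    (hΦb : ∀ y, ‖Φ y‖ ≤ M * Real.exp (-|y| / 2)) {L : ℝ} (hL : 0 < L) :
    Continuous fun x : ℝ => ∑' k : ℤ, Φ (x + k * L) := by
  -- summability of `k ↦ e^{-|k| L / 2}` over `ℤ`
  have hq : Real.exp (-(L / 2)) < 1 := Real.exp_lt_one_iff.2 (by linarith)
  have hq0 : 0 ≤ Real.exp (-(L / 2)) := (Real.exp_pos _).le
  have hgeom : Summable fun n : ℕ => Real.exp (-(L / 2)) ^ n := summable_geometric_of_lt_one hq0 hq
  have hterm : ∀ n : ℕ, Real.exp (-((n : ℝ) * L) / 2) = Real.exp (-(L / 2)) ^ n := by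
    intro n
    rw [← Real.exp_nat_mul]; congr 1; ring
  have hsumZ : Summable fun k : ℤ => Real.exp (-(|(k : ℝ)| * L) / 2) := by
    refine Summable.of_nat_of_neg ?_ ?_
    · refine hgeom.congr fun n => ?_
      rw [← hterm n, Int.cast_natCast, abs_of_nonneg (Nat.cast_nonneg n)]
    · refine hgeom.congr fun n => ?_
      rw [← hterm n, Int.cast_neg, Int.cast_natCast, abs_neg, abs_of_nonneg (Nat.cast_nonneg n)]
  -- continuity on every `[-R, R]`
  rw [continuous_iff_continuousAt]
  intro x₀
  set R : ℝ := |x₀| + 1 with hR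
  have hcont : ContinuousOn (fun x : ℝ => ∑' k : ℤ, Φ (x + k * L)) (Icc (-R) R) := by
    refine continuousOn_tsum (u := fun k : ℤ => M * Real.exp (R / 2) * Real.exp (-(|(k : ℝ)| * L) / 2))
      (fun k => (hΦc.comp (continuous_id.add continuous_const)).continuousOn) (hsumZ.mul_left _) ?_
    intro k x hx
    have hxR : |x| ≤ R := abs_le.2 ⟨hx.1, hx.2⟩
    have htri : |(k : ℝ)| * L - R ≤ |x + k * L| := by
      have h1 : |(k : ℝ) * L| ≤ |x + k * L| + |x| := by
        have := abs_sub (x + k * L) x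
        simp only [add_sub_cancel_left] at this
        linarith [abs_sub_comm (x + k * L) x]
      rw [abs_mul, abs_of_pos hL] at h1
      linarith
    calc ‖Φ (x + k * L)‖ ≤ M * Real.exp (-|x + k * L| / 2) := hΦb _
      _ ≤ M * Real.exp ((R - |(k : ℝ)| * L) / 2) := by gcongr; linarith
      _ = M * Real.exp (R / 2) * Real.exp (-(|(k : ℝ)| * L) / 2) := by
          rw [mul_assoc, ← Real.exp_add]; congr 2; ring
  have hmem : Icc (-R) R ∈ 𝓝 x₀ :=
    Icc_mem_nhds (by rw [hR]; linarith [neg_abs_le x₀]) (by rw [hR]; linarith [le_abs_self x₀])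
  exact hcont.continuousAt hmem

/-- **`Σ_μ 𝓔(f)` is a continuous function on the circle** for a real Schwartz `f` with `∫_0^∞ f = 0`
(Lemma 6.1 (ii), Schwartz case: "`Σ_μ 𝓔(f)` … defines a bounded measurable function on `ℝ₊^*/μ^ℤ`",
p0018:L24; continuity follows from the uniform geometric convergence of its proof, L57–L58).
[cite: ConnesConsani2023, Lemma 6.1 (ii) (arXiv chunk p0018:L24, L57–L58)] -/
theorem continuous_sigmaE {L : ℝ} (hL : 0 < L) (f : 𝓢(ℝ, ℝ)) (hint : ∫ t in Ioi 0, f t = 0) :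
    Continuous (sigmaE L f) := by
  obtain ⟨M, hM0, hM⟩ := norm_connesE_exp_le f hint
  have hP : Continuous fun x : ℝ => ∑' k : ℤ, ((connesE f (Real.exp (x + k * L)) : ℝ) : ℂ) :=
    continuous_tsum_comp_add_int_mul (Φ := fun y => ((connesE f (Real.exp y) : ℝ) : ℂ))
      (continuous_connesE_comp_exp f) hM0 hM hL
  have hcomp : (sigmaE L f) ∘ (QuotientAddGroup.mk : ℝ → AddCircle L) =
      fun x : ℝ => ∑' k : ℤ, ((connesE f (Real.exp (x + k * L)) : ℝ) : ℂ) := by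
    funext x
    exact sigmaE_coe_eq_tsum L f x
  rw [(QuotientAddGroup.isQuotientMap_mk (AddSubgroup.zmultiples L)).continuous_iff, hcomp]
  exact hP

/-- Hence `Σ_μ 𝓔(f) ∈ L²(C)`: there is an `L²` class a.e. equal to it (the one used to populate
`zetaCycleGenerators`). [cite: ConnesConsani2023, Lemma 6.1 (ii) (arXiv chunk p0018:L24)] -/
theorem exists_lp_ae_eq_sigmaE {L : ℝ} [hL : Fact (0 < L)] (f : 𝓢(ℝ, ℝ))
    (hint : ∫ t in Ioi 0, f t = 0) :
    ∃ ξ : Lp ℂ 2 (@haarAddCircle L hL), (ξ : AddCircle L → ℂ) =ᵐ[haarAddCircle] sigmaE L f :=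
  ⟨ContinuousMap.toLp (E := ℂ) 2 haarAddCircle ℂ ⟨sigmaE L f, continuous_sigmaE hL.out f hint⟩,
    ContinuousMap.coeFn_toLp (E := ℂ) (p := 2) haarAddCircle (𝕜 := ℂ) _⟩

/-! ### Theorem 6.4 (i) -/

/-- **Theorem 6.4 (i)** (discharge of `CC2023_thm_6_4_i`): the spectrum of the action of `ℝ₊^*` on
`𝓗(L) = Σ_μ 𝓔(𝒮^ev_0)^⊥` consists of imaginary parts of zeros of `ζ` on the critical line: if
`χ_s ∈ 𝓗(L)` then `ζ(½ + is) 𝓜f(½ + is) = L · conj⟨χ_s | Σ_μ 𝓔 f⟩ = 0` for the test function `f`,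
and `𝓜f(½ + is) ≠ 0`.  RH-FREE; nothing here bears on the truth of RH.
[cite: ConnesConsani2023, Theorem 6.4 (i) (arXiv chunk p0019:L16–L46); Theorem 1.1 (i) (p0002:L25)] -/
theorem CC2023_thm_6_4_i_holds : CC2023_thm_6_4_i := by
  intro L hL s hs
  obtain ⟨n, hsL, hmem⟩ := hs
  obtain ⟨F, hFval, hFmem⟩ := CC2023_gaussWitness_mem_holds
  have hint : ∫ t in Ioi 0, F t = 0 := integral_Ioi_eq_zero_of_even F.integrable hFmem.1 hFmem.2.2
  obtain ⟨ξ, hξ⟩ := exists_lp_ae_eq_sigmaE (L := L) F hint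
  have hgen : ξ ∈ zetaCycleGenerators L := ⟨F, hFmem, hξ⟩
  have horth : inner ℂ (fourierLp 2 n : Lp ℂ 2 (@haarAddCircle L hL)) ξ = 0 := by
    have h := Submodule.inner_right_of_mem_orthogonal (Submodule.subset_span hgen) hmem
    rw [← inner_conj_symm, h, map_zero]
  rw [inner_fourierLp_eq_zeta_mul_mellin F hint hξ hsL, smul_eq_zero] at horth
  have hL0 : (L⁻¹ : ℝ) ≠ 0 := inv_ne_zero hL.out.ne'
  have h0 : riemannZeta (1 / 2 + s * I) * mellin (fun x => ((F x : ℝ) : ℂ)) (1 / 2 + s * I) = 0 := by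
    rcases horth with h | h
    · exact absurd h hL0
    · exact (map_eq_zero_iff (starRingEnd ℂ) (RingHom.injective _)).1 h
  have hF : (fun x => ((F x : ℝ) : ℂ)) = fun x => ((gaussWitness x : ℝ) : ℂ) := by
    funext x; rw [hFval]
  rw [hF] at h0
  exact (mul_eq_zero.1 h0).resolve_right (mellin_gaussWitness_ne_zero s)

end Literature.NumberTheory.ConnesConsani2023.ZetaCycles
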